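import Mathlib
import Summits.Parity.BatemanHorn.Theses.PolynomialMobius
import Summits.Parity.BatemanHorn.Theorems.PolyMobiusTail.Negative.Structure

/-!
# Crux `PolyMobiusTail` (stmt-Parity-0870), skeleton v5 of line `eta-free-multilinear-window`:
# the hyper-incomplete BAND of the large part is EMPTY for total degree `G ≤ 2`

Skeleton v5 (`Cruxes/PolyMobiusTail/Lines/stub_window_linear_le_one.lean`, lead c5) reshapes the
registered stub `stub_large` (cofactor form of the large divisor range `∏ dᵢ > x^{1+θ}`) into
CORE (`∏ eᵢ ≤ x^{1-δ}`: complete cofactor pencils — the parity statement proper) and BAND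
(`∏ eᵢ > x^{1-δ}`: hyper-incomplete), coupled by `δ < θ` (census gen 4, D20).  This file proves the
size fact that makes the band a `G ≥ 3` phenomenon: for `∑ deg fᵢ ≤ 2` and `δ < θ` the band is
eventually EMPTY, because `∏ dᵢ · ∏ eᵢ = ∏ fᵢ(n) ≪ x^{G} ≤ x²` while the two cuts force
`∏ dᵢ · ∏ eᵢ > x^{2+θ-δ}`.  So on linear pairs and on one quadratic the whole large part is core.
-/

open scoped BigOperators
open Filter Finset Polynomial Asymptotics

namespace Summit.Parity.BatemanHorn.Theorems.PolyMobiusTail.EtaFreeWindow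

/-- **The hyper-incomplete band of the large part is EMPTY for total degree `G ≤ 2` (pure size).**
If `∑ᵢ deg fᵢ ≤ 2` and `δ < θ` then eventually in `x` no pair `(n, e)` with `1 ≤ n ≤ x`, `eᵢ ∣ fᵢ(n)⁺`
satisfies both `x^{1+θ} < ∏ᵢ fᵢ(n)⁺/eᵢ` and `x^{1-δ} < ∏ᵢ eᵢ`: multiplying the two brackets,
`x^{2+θ-δ} < ∏ᵢ (fᵢ(n)⁺/eᵢ)·eᵢ ≤ ∏ᵢ fᵢ(n)⁺ ≤ (∏ᵢ Σⱼ|aᵢⱼ|)·x^{G} ≤ (∏ᵢ Σⱼ|aᵢⱼ|)·x²`, which fails once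
`x^{θ-δ} > ∏ᵢ Σⱼ|aᵢⱼ|`.  Hence the band function (cofactor-Möbius weights on that range) is eventually
the zero function; in skeleton v5 this discharges the band stub for every system of total degree `≤ 2`
(linear pairs, one quadratic), leaving the band registered for `G ≥ 3` only. [folklore] -/
theorem largeBand_eventually_eq_zero_of_totalDegree_le_two {k : ℕ} (f : Fin k → ℤ[X])
    (hG : ∑ i, (f i).natDegree ≤ 2) {θ δ : ℝ} (hδθ : δ < θ) :
    ∀ᶠ x : ℕ in atTop, (∑ n ∈ Finset.Icc 1 x,
      ∑ e ∈ Fintype.piFinset (fun i => (((f i).eval (n : ℤ)).toNat).divisors),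
        if (x : ℝ) ^ (1 + θ) < ∏ i, ((((f i).eval (n : ℤ)).toNat / e i : ℕ) : ℝ) ∧
            (x : ℝ) ^ (1 - δ) < ∏ i, (e i : ℝ) then
          ∏ i, ((ArithmeticFunction.moebius (((f i).eval (n : ℤ)).toNat / e i) : ℝ) *
            Real.log ((((f i).eval (n : ℤ)).toNat / e i : ℕ) : ℝ)) else 0) = 0 := by
  set B : Fin k → ℕ := fun i => ∑ j ∈ Finset.range ((f i).natDegree + 1), ((f i).coeff j).natAbs
    with hB
  have hpos : 0 < θ - δ := sub_pos.mpr hδθ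
  have hev : ∀ᶠ x : ℕ in atTop, ((∏ i, B i : ℕ) : ℝ) < (x : ℝ) ^ (θ - δ) :=
    ((tendsto_rpow_atTop hpos).comp tendsto_natCast_atTop_atTop).eventually_gt_atTop _
  filter_upwards [hev, eventually_ge_atTop 1] with x hx hx1
  have hx0 : (0 : ℝ) < x := by exact_mod_cast hx1
  have hx1' : (1 : ℝ) ≤ x := by exact_mod_cast hx1
  refine Finset.sum_eq_zero fun n hn => Finset.sum_eq_zero fun e _ => ?_
  rw [if_neg]
  rintro ⟨hA, hE⟩
  obtain ⟨hn1, hnx⟩ := Finset.mem_Icc.mp hn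
  -- product of the two brackets
  have hlt : (x : ℝ) ^ (1 + θ) * (x : ℝ) ^ (1 - δ) <
      (∏ i, ((((f i).eval (n : ℤ)).toNat / e i : ℕ) : ℝ)) * ∏ i, (e i : ℝ) :=
    mul_lt_mul'' hA hE (by positivity) (by positivity)
  -- the right side is at most `(∏ B i) · x²`
  have hFi : ∀ i, (((f i).eval (n : ℤ)).toNat / e i) * e i ≤ B i * x ^ (f i).natDegree := fun i =>
    (Nat.div_mul_le_self _ _).trans
      ((Negative.toNat_eval_le_mul_pow (f i) hn1).trans
        (Nat.mul_le_mul_left _ (Nat.pow_le_pow_left hnx _)))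
  have hle : (∏ i, ((((f i).eval (n : ℤ)).toNat / e i : ℕ) : ℝ)) * ∏ i, (e i : ℝ)
      ≤ ((∏ i, B i : ℕ) : ℝ) * (x : ℝ) ^ (2 : ℝ) := by
    rw [← Finset.prod_mul_distrib]
    have h1 : ∏ i, (((((f i).eval (n : ℤ)).toNat / e i : ℕ) : ℝ) * (e i : ℝ))
        ≤ ∏ i, ((B i : ℝ) * (x : ℝ) ^ (f i).natDegree) := by
      refine Finset.prod_le_prod (fun i _ => by positivity) fun i _ => ?_
      exact_mod_cast hFi i
    refine h1.trans ?_
    rw [Finset.prod_mul_distrib, Finset.prod_pow_eq_pow_sum, Nat.cast_prod, Real.rpow_two]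
    refine mul_le_mul_of_nonneg_left (pow_le_pow_right₀ hx1' hG) (by positivity)
  -- the left side exceeds `(∏ B i) · x²`
  have hge : ((∏ i, B i : ℕ) : ℝ) * (x : ℝ) ^ (2 : ℝ) < (x : ℝ) ^ (1 + θ) * (x : ℝ) ^ (1 - δ) := by
    rw [← Real.rpow_add hx0, show (1 + θ) + (1 - δ) = (θ - δ) + 2 by ring, Real.rpow_add hx0]
    exact mul_lt_mul_of_pos_right hx (Real.rpow_pos_of_pos hx0 _)
  exact absurd (hge.trans hlt) (not_lt.mpr hle)

/-- **Stub `stub_large_band_le_two` (skeleton v5 of crux stmt-Parity-0870): for total degree `G ≤ 2`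
the BAND part of the large range is `o(x)` — indeed eventually `0` — for every `δ < θ`.**
`Σ_{n≤x} Σ_{eᵢ ∣ fᵢ(n), ∏ fᵢ(n)/eᵢ > x^{1+θ}, ∏ eᵢ > x^{1-δ}} ∏ μ(fᵢ(n)/eᵢ) log(fᵢ(n)/eᵢ) = o(x)` whenever
`∑ deg fᵢ ≤ 2` (no Bateman–Horn axiom needed): the range is empty once `x^{θ-δ} > ∏ᵢ Σⱼ|aᵢⱼ|`
(`largeBand_eventually_eq_zero_of_totalDegree_le_two`).  This is the `G ≤ 2` half of the census-D20
band; the `G ≥ 3` half stays registered as `stub_large_band_three_le`. [folklore] -/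
theorem stub_large_band_le_two : ∀ (k : ℕ) (f : Fin k → ℤ[X]), ∑ i, (f i).natDegree ≤ 2 →
    ∀ θ δ : ℝ, δ < θ →
    (fun x : ℕ => ∑ n ∈ Finset.Icc 1 x,
      ∑ e ∈ Fintype.piFinset (fun i => (((f i).eval (n : ℤ)).toNat).divisors),
        if (x : ℝ) ^ (1 + θ) < ∏ i, ((((f i).eval (n : ℤ)).toNat / e i : ℕ) : ℝ) ∧
            (x : ℝ) ^ (1 - δ) < ∏ i, (e i : ℝ) then
          ∏ i, ((ArithmeticFunction.moebius (((f i).eval (n : ℤ)).toNat / e i) : ℝ) *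
            Real.log ((((f i).eval (n : ℤ)).toNat / e i : ℕ) : ℝ)) else 0)
      =o[atTop] fun x : ℕ => (x : ℝ) := by
  intro k f hG θ δ hδθ
  refine (isLittleO_zero (fun x : ℕ => (x : ℝ)) atTop).congr' ?_ EventuallyEq.rfl
  filter_upwards [largeBand_eventually_eq_zero_of_totalDegree_le_two f hG hδθ] with x hx
  exact hx.symm

end Summit.Parity.BatemanHorn.Theorems.PolyMobiusTail.EtaFreeWindow
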